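import Mathlib
import HarnessLib
import Summits.CriticalPhenomena.CardyFormulaZ2.Theses.CardyComplexCone
import Literature.Probability.LatticeModels.MedialWinding
import Literature.Analysis.Complex.LoewnerLemma

/-!
# Sketch — first lemmas of the three crux-idea cards for
`CardyComplexCone.ParafermionToSLESixFamilies` (stmt-CriticalPhenomena-11389), round 1, ideator 3.

Each `def … : Prop` is the FIRST CHECKABLE STATEMENT of one line (cards in `Ideas/`); nothing is
proved here (crux-ideate files no skeleton).
-/

namespace Summit.CriticalPhenomena.CardyFormulaZ2.Cruxes.ParafermionToSLESixFamilies.Sketch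

open scoped BigOperators Topology Real
open Filter Set Metric MeasureTheory Complex
open Literature.Probability.LatticeModels Literature.Probability.Percolation

/-! ## Card A `terminal-anchor-ratio-martingale` — first lemma

EXACT lattice identity behind terminal anchoring: for admissible square-lattice Dobrushin data,
the exploration path traverses the corner `(w, f)` of an inner face `f` bordering the (frozen)
arc `B` iff the primal site `w` is joined to the arc `A` by `bcBondConfig`-open edges. Hence,
for such boundary corners, the spin-`σ` observable is a DETERMINISTIC unit times the connection
probability `P(w ↔ A)`, and `t ↦ P(w ↔ A ∣ 𝓕_t)` is the Doob martingale of a monotone event. -/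
def BoundaryPassageIffConnectedToA : Prop :=
  ∀ (E : DiscreteDobrushin), E.IsZdAdmissible →
    ∀ (ω : BondConfig (Site 2)) (w f : Site 2),
      IsCorner w f → E.IsInnerFace f → (∃ y : Site 2, IsCorner y f ∧ y ∈ E.zdArcB) →
      w ∉ E.zdArcB →
      ((∃ k : ℕ, (medialExploration E ω)[k]? = some (cornerSource w f) ∧
            (medialExploration E ω)[k + 1]? = some (cornerTarget w f)) ↔
        ∃ x ∈ E.zdArcA, (openGraph (E.bcBondConfig ω)).Reachable w x)

/-! ## Card B `koebe-envelope-funnel` — first lemma (= the load-bearing a-priori estimate SIE)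

Uniform scale-invariant (Koebe-type) envelope for the spin-1/3 vertex observable of bond
percolation on `ℤ²` at `p = 1/2`: ONE constant `C` for ALL admissible discrete Dobrushin data,
`‖F_δ(z)‖ ≤ C δ^{1/3} d(z)^{-1/3}`, `d(z)` the distance of the medial point to the complement of
the domain (at least one mesh). It is the lattice shadow of Koebe distortion
`|φ'(z)|^{1/3} ≤ 2^{1/3} d(z)^{-1/3}` for the conjectured limit `(φ')^{1/3}`. -/
def KoebeEnvelope : Prop :=
  ∃ C : ℝ, 0 < C ∧ ∀ (E : DiscreteDobrushin), E.IsZdAdmissible →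
    ∀ z : MedialVertex, z ∈ (zdGraph 2).edgeSet → (∀ x ∈ z, x ∈ meshDomain E.Ω E.δ) →
      E.δ ≤ infDist (medialPoint E.δ z) E.Ωᶜ →
      ‖∫ ω, MedialPath.passageSum (medialExploration E ω) E.δ (1 / 3) z
          ∂(bondPercolation (zdGraph 2) half)‖
        ≤ C * E.δ ^ ((1 : ℝ) / 3) * (infDist (medialPoint E.δ z) E.Ωᶜ) ^ (-(1 : ℝ) / 3)

/-! ## Card C `left-passage-foliation-lock` — first lemma (pure analysis, provable now)

FOLIATION IDENTIFICATION on the disc: if a harmonic function `H` (think `Im ∫ f³`, `f` a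
holomorphic subsequential limit of `δ^{-1/3} F_δ`) is a function of a continuous field `ℓ`
(think: the left-passage probability) that tends to `1` on the open arc `(α, β)` and to `0` on
the complementary open arc, then `H` is an affine function of the harmonic measure of the arc —
with NO hypothesis on `H` or `ℓ` at the two endpoints and no a-priori bound on `H`
(cross-cut boundedness of `G` in the middle, harmonic-measure boundedness near the arcs,
Lindelöf's maximum principle with two exceptional points, Fatou radial limits vs. oscillation). -/
def FoliationIdentification : Prop :=
  ∀ (α β : ℝ), α < β → β - α < 2 * π →
    ∀ (H ℓ : ℂ → ℝ) (G : ℝ → ℝ),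
      InnerProductSpace.HarmonicOnNhd H (ball (0 : ℂ) 1) →
      ContinuousOn ℓ (ball (0 : ℂ) 1) →
      (∀ t ∈ Ioo α β, Tendsto ℓ (𝓝[ball (0 : ℂ) 1] (exp (t * I))) (𝓝 1)) →
      (∀ t ∈ Ioo β (α + 2 * π), Tendsto ℓ (𝓝[ball (0 : ℂ) 1] (exp (t * I))) (𝓝 0)) →
      (∀ z ∈ ball (0 : ℂ) 1, H z = G (ℓ z)) →
      ∃ c₀ c₁ : ℝ, ∀ z ∈ ball (0 : ℂ) 1,
        H z = c₀ + c₁ * Literature.Analysis.Complex.arcHM α β z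

end Summit.CriticalPhenomena.CardyFormulaZ2.Cruxes.ParafermionToSLESixFamilies.Sketch
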